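import Literature.AlgebraicGeometry.Resolution.InseparableLocalUniformizationEngine
import HarnessLib

/-!
# Inseparable local uniformization: Steps 3–4 of the proof of Thm. 4.1.1 — corrected rendering

Topic: `Literature/AlgebraicGeometry/Resolution`. M. Temkin, *Inseparable local uniformization*,
J. Algebra 373 (2013) 65–119 = arXiv:0804.1554v3, proof of Thm. 4.1.1, Steps 3–4 (pp. 48–49;
p. 30 of the 41-pp. arXiv version held in the literature store) and §4.2, Step 2 (p. 51).
(Module docstring restored from the version of this file by the `Temkin2013HeightStepOfDescent`
seat, which vendored the corrected fact first; the present text merges both submissions.)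

The named fact `Temkin2013_Steps34` (`InseparableLocalUniformizationEngine.lean`) renders these
steps for one finite valued extension `(K₁, K₁°)/(K, K°)`; its binders for `K₁` read
`∀ (K₁ : Type u) [Field K₁] [Algebra K K₁] [Algebra k̄ K₁] [IsScalarTower k̄ K K₁]` with `k̄` an
`IntermediateField k K`. **This rendering is defective (MIS-RENDERED):** `#print` with
`pp.explicit` shows that the tower binder elaborates to
`@IsScalarTower ↥k̄ K K₁ (IntermediateField.instSMulSubtypeMem …) (Algebra.toSMul K K₁ _)
(IntermediateField.instSMulSubtypeMem … K₁ (Algebra.toSMul K K₁ _))`, i.e. to the tower for the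
`k̄`-action on `K₁` INHERITED from `K` (automatic, `IntermediateField.instAlgebraSubtypeMem`),
whereas the models `etaModel ↥k̄ K₁ … inst …`, `etaModelBaseMap …` in the hypotheses `hXS`, `hSE`
use the SEPARATE binder instance `inst : Algebra ↥k̄ K₁`. That binder is therefore a free,
unconstrained field embedding `ι : k̄ → K₁`, the tower hypothesis is vacuously the automatic one,
and the fact quantifies over ALL embeddings `ι`: its hypotheses speak of
`C₁ = Nr_{K₁}(Nr_{K₁}(A)·ι(k̄°))` and of smooth-equivalence over `ι(k̄°)`. The printed Steps 3–4
(refine `Y = Spec B ⊆ k̄`, form `X′ = Nr_K(X ×_Y Y′) = Nr_K(A·B′)` INSIDE `K`, apply Thm. 4.1.1 to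
`Y`, extend `k̄ ⊆ K ⊆ K₁` purely inseparably, Lemma 2.8.5, descent of smoothness) require `ι` to
be the inclusion `k̄ ⊆ K → K₁`; for a wild `ι` they do not apply (the refinement `X′` of `X` and
the purely inseparable `l/k` inside `lK₁` cannot be formed), so `Temkin2013_Steps34` is stronger
than what the paper proves and is not provable along the printed lines (nor refutable short of
disproving inseparable local uniformization, its conclusion being Thm. 4.1.1's). Both users in
the tree (`Temkin2013DescentDefectStep.of_relativeCurve_of_steps34`,
`InseparableLocalUniformizationDefectStep.lean`; `relConclusion_of_normalForm_nft`,
`InseparableLocalUniformizationHeightStepTwo.lean`) instantiate `ι` with the inherited instance,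
i.e. they only ever use the intended specialisation. (Audit first recorded as ledger p14842 by
the former `Temkin2013HeightLeOne` seat; mathematics confirmed by two independent reviews.)

This file vendors the CORRECTED rendering and relates it to the old one:

* `Temkin2013_Steps34_tower` — NAMED FACT: verbatim `Temkin2013_Steps34` with the binders
  `[Algebra k̄ K₁] [IsScalarTower k̄ K K₁]` DROPPED, so that `k̄` acts on `K₁` through `K`
  (`IntermediateField.instAlgebraSubtypeMem`, for which `IsScalarTower k̄ K K₁` holds
  automatically; `Temkin2013_Steps34_tower.algebraMap_apply` is `rfl`). This is the statement
  the printed Steps 3–4 prove; it is DISCHARGED downstream — `Temkin2013_Steps34_tower_holds`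
  (`InseparableLocalUniformizationStepsThreeFourHolds.lean`: `descentConclusionWeak_of_steps34Data`
  of `…StepsThreeFourWeak.lean` — Lemma 2.8.4 `Temkin2013_Lemma284_holds`, openness of `S₁` in
  `Nr_m(S)` `Temkin2013_valuationRingOpen_holds`, Lemma 2.8.5 for normal schemes
  `Temkin2013_Lemma285_normal_holds`, descent of smoothness along smooth covers — followed by the
  final enlargement of `l`, `Temkin2013DescentConclusion.of_weak` of `…SimplePoint.lean`).
* `Temkin2013_Steps34_tower.of_steps34` (alias `Temkin2013_Steps34.tower`) — PROVED: the old
  rendering implies the corrected one (specialise `ι` to the inherited structure), so every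
  frontier theorem stated with `Temkin2013_Steps34` remains available from the weaker, correct
  fact's consequences and nothing in the tree is invalidated; conversely the frontier should
  henceforth list `Temkin2013_Steps34_tower`.

Status of the re-plumbing: the users have tower variants in
`InseparableLocalUniformizationDefectStepTower.lean`, `…HeightStepTwoTower.lean`,
`…HeightInductionTower.lean` (and `DefectTowers.lean`), made unconditional in this hypothesis by
`Temkin2013_Steps34_tower_holds` (`…StepsThreeFourHolds.lean`, `…HeightStepFinal.lean`,
`…DefectStepFrontier.lean`, `…HeightLeOneFrontier.lean`). The over-strong `Temkin2013_Steps34`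
is DEPRECATED (verdict clean-up 2026-08-16, `InseparableLocalUniformizationEngine.lean`; statement
kept verbatim for its ledger-referenced legacy users); the two bridge theorems below must name it
and switch `linter.deprecated` off for themselves alone.

## Sources

* M. Temkin, *Inseparable local uniformization*, arXiv:0804.1554v3, proof of Thm. 4.1.1, Steps
  1 ("the embedding `k̄ ↪ K` induces a morphism `X → Y`"), 3–4 and Remark 4.1.2 (pp. 47–49);
  §4.2, Step 2 (p. 51).

## Rendering notes

* Exactly those of `InseparableLocalUniformizationEngine.lean`; the only change is that the
  `k̄`-algebra structure of `K₁` is the composite `k̄ ⊆ K → K₁`.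
-/

noncomputable section

namespace Literature.AlgebraicGeometry.Resolution

universe u

/-- NAMED FACT (corrected rendering of `Temkin2013_Steps34`) — **Steps 3–4 of the proof of
Temkin's Thm. 4.1.1, the engine common to §4.1 and §4.2**, with the base `k̄ = kb` acting on the
finite extension `K₁` of `K` THROUGH `kb ≤ K → K₁` (proof of Thm. 4.1.1, Step 1, p. 47: "the
embedding `k̄ ↪ K` induces a morphism `X → Y`"; Steps 3–4, pp. 48–49: "Refine `Y` and replace
the other entries of diagram (3) with the `η`-normalized base changes so that `xᵢ` and `yᵢ`
become smooth-equivalent … by Lemma 2.8.4 there exists `α` such that the points `x_{i,α}` and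
`y_{i,α}` are smooth-equivalent over `Y_α`"; "Smoothen the points `yᵢ` by an additional
refining of `Y` and a purely inseparable extension of `k` … `xᵢ` are still smooth-equivalent to
`yᵢ` by Lemma 2.8.5 … In particular, `x₁` is `l`-smooth, and, replacing `l` with a purely
inseparable extension, we can also arrange that `x₁` is a simple `l`-smooth point"; §4.2, Step
2, p. 51). Data, hypotheses and conclusion are those of `Temkin2013_Steps34`
(`InseparableLocalUniformizationEngine.lean`, see its docstring for the dictionary) VERBATIM,
except that the binders `[Algebra kb K₁] [IsScalarTower kb K K₁]` of that rendering — which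
made the `kb`-structure of `K₁` used by `etaModel`/`etaModelBaseMap` an arbitrary ring map
(audit, ledger p14842) — are removed: here `Algebra kb K₁` is the structure inherited from
`Algebra K K₁`. DISCHARGED downstream: `Temkin2013_Steps34_tower_holds`
(`InseparableLocalUniformizationStepsThreeFourHolds.lean`, from `Temkin2013_Lemma284_holds`,
`Temkin2013_Lemma285_normal_holds`, `Temkin2013_valuationRingOpen_holds`, descent of smoothness
and `Temkin2013DescentConclusion.of_weak`); users upstream of that file take
`(h : Temkin2013_Steps34_tower)` and are fed `Temkin2013_Steps34_tower_holds`.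
[cite: Temkin2013, proof of Thm. 4.1.1, Steps 3–4 (arXiv:0804.1554v3 pp. 48–49) and Section 4.2, Step 2 (p. 51)] -/
def Temkin2013_Steps34_tower : Prop :=
  ∀ (k K : Type u) [Field k] [Field K] [Algebra k K], (⊤ : IntermediateField k K).FG →
  ∀ (O : ValuationSubring K), (∀ c : k, algebraMap k K c ∈ O) →
  ∀ (kb : IntermediateField k K), (⊤ : IntermediateField k kb).FG →
    ringKrullDim (O.comap (algebraMap kb K)) ≤ 1 →
    Temkin2013DescentFor k kb (O.comap (algebraMap kb K)) →
  ∀ (B : Subalgebra k kb), B.toSubring ≤ (O.comap (algebraMap kb K)).toSubring → B.FG →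
    IsFractionRing B kb →
  ∀ (A : Subalgebra k K), A.toSubring ≤ O.toSubring → A.FG → IsFractionRing A K →
    (∀ x : K, IsIntegral A x → x ∈ A) → (∀ b : B, algebraMap kb K b ∈ A) →
  ∀ (K₁ : Type u) [Field K₁] [Algebra K K₁], FiniteDimensional K K₁ →
  ∀ (O₁ : ValuationSubring K₁), O₁.comap (algebraMap K K₁) = O →
  ∀ (m : Type u) [Field m] [Algebra kb m], FiniteDimensional kb m →
  ∀ (Om : ValuationSubring m), Om.comap (algebraMap kb m) = O.comap (algebraMap kb K) →
  ∀ (hXS : etaModel kb (nrIn (A.toSubring.map (algebraMap K K₁)))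
      (O.comap (algebraMap kb K)).toSubring ≤ O₁.toSubring)
    (hOm : ∀ c : (O.comap (algebraMap kb K)).toSubring, algebraMap kb m c ∈ Om),
    AreSmoothEquivalent
      (etaModelBaseMap (nrIn (A.toSubring.map (algebraMap K K₁)))
        (O.comap (algebraMap kb K)).toSubring)
      (((algebraMap kb m).comp (O.comap (algebraMap kb K)).toSubring.subtype).codRestrict Om hOm)
      ((IsLocalRing.maximalIdeal O₁).comap (Subring.inclusion hXS))
      (IsLocalRing.maximalIdeal Om) →
    Temkin2013DescentConclusion k K O A K₁ O₁

/-- The `kb`-algebra structure of `K₁` used in `Temkin2013_Steps34_tower` is the one through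
`K`: `algebraMap kb K₁ = algebraMap K K₁ ∘ algebraMap kb K`. [folklore] -/
theorem Temkin2013_Steps34_tower.algebraMap_apply {k K : Type u} [Field k] [Field K]
    [Algebra k K] (kb : IntermediateField k K) (K₁ : Type u) [Field K₁] [Algebra K K₁]
    (c : kb) : algebraMap kb K₁ c = algebraMap K K₁ c := rfl

-- `linter.deprecated` is switched off for the next declaration only: its hypothesis IS the
-- mis-rendered fact `Temkin2013_Steps34`, deprecated (2026-08-16) in
-- `InseparableLocalUniformizationEngine.lean` in favour of `Temkin2013_Steps34_tower` above; the
-- bridge is kept as the machine-checked record that the correction only specialises the old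
-- statement (and for the legacy users of the old name).
set_option linter.deprecated false in
/-- **The tree's first rendering implies the corrected one**: specialize the arbitrary
`kb`-structure of `K₁` in the deprecated, mis-rendered `Temkin2013_Steps34` to the one through
`K`. (The converse is not claimed: `Temkin2013_Steps34` is stronger than printed. New work needs
neither: `Temkin2013_Steps34_tower_holds`.) [folklore] -/
theorem Temkin2013_Steps34.tower (h : Temkin2013_Steps34.{u}) : Temkin2013_Steps34_tower.{u} := by
  intro k K _ _ _ hfg O hO kb hkbfg hdim hD B hBO hBfg hBfr A hAO hAfg hAfr hAn hBA K₁ _ _ hfin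
    O₁ hO₁ m _ _ hmfin Om hOm' hXS hOm hSE
  exact h k K hfg O hO kb hkbfg hdim hD B hBO hBfg hBfr A hAO hAfg hAfr hAn hBA K₁ hfin O₁ hO₁
    m hmfin Om hOm' hXS hOm hSE

-- `linter.deprecated` off for the next declaration only (same reason: it names the deprecated
-- `Temkin2013_Steps34` as its hypothesis).
set_option linter.deprecated false in
/-- Same implication, under the name recorded by the audit proposal p14842 (hypothesis: the
deprecated, mis-rendered `Temkin2013_Steps34`; new work uses `Temkin2013_Steps34_tower_holds`).
[folklore] -/
theorem Temkin2013_Steps34_tower.of_steps34 (h : Temkin2013_Steps34.{u}) :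
    Temkin2013_Steps34_tower.{u} :=
  Temkin2013_Steps34.tower h

end Literature.AlgebraicGeometry.Resolution

end
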